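import Literature.MathematicalPhysics.QuantumFieldTheory.AbelianHiggsTorusClustering
import HarnessLib

/-!
# The perimeter law for Wilson loops in the Higgs phase of finite abelian lattice gauge theories (torus states)

Support file for the discharge of `Literature.Barriers.QuantumFields.ZnHiggsPhaseD4` through the
torus core fact `ZnTorusPerimeterLawD4` of `DiscreteSubgroupFreezingProofs.lean`. For a finite
abelian gauge group `G`, a continuous matrix representation `ρ` with an action gap and a symmetric
Wilson weight (`Re tr ρ(g⁻¹) = Re tr ρ(g)`), and a unitary character `χ` of `G`, the torus Wilson
states at large `β` satisfy, uniformly in the volume, the **perimeter law lower bound**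
`e^{-c · 2(R+T)} ≤ ⟨Re χ(hol_{R×T})⟩_{Λ_{L+1}, β}` (`abelianHiggs_torus_perimeterLaw`).

Proof ("Peierls argument for the Wilson loop", Montvay–Münster §3.7.1 item 3): by the abelian
Stokes theorem the loop variable is the character of the total flux through the rectangle,
`χ(hol) = ∏_{p ∈ R×T} χ̂(ω_U(p))`, a multiplicative observable `ψ` of the plaquette field. In the
vortex-gas cluster expansion (`AbelianContourClusterExpansion`), `⟨ψ⟩_closed = exp ∑_C dPhi ψ C`,
and the dressed activity of a cube-connected vortex `X` differs from the undressed one only if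
`X` is large (`2 #X ≥ L`) or lies within distance `#X` of a boundary site of the rectangle:
a small closed vortex supported on `X` is `td₁ θ` with `θ` supported within distance `#X` of
`X` (`exists_td₁_eq_ext_of_connected_small`, the torus Poincaré lemma with support control), and
then the total flux through the rectangle is the line sum of `θ` around its boundary (Stokes),
which vanishes. The Kotecký–Preiss estimate (4) bounds the contribution of the clusters through a
given vortex `X` by `#X e^{-τ #X}`; summing over the vortices near the `2(R+T)` boundary sites
gives `|∑_C dPhi ψ C| ≤ K · 2(R+T) + o_L(1)`. Positivity of `⟨ψ⟩_closed` (it is real by the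
symmetry `η ↦ -η`, non-zero along the interpolation `χ̂ ↦ s χ̂ + (1-s)` by the convergence of the
expansion, and `= 1` at `s = 0`) turns this into `⟨ψ⟩_closed ≥ e^{-K·2(R+T) - o(1)}`, and the
exact-versus-closed comparison (`norm_exactAvg_sub_closedAvg_le`) transfers it to the link
ensemble.

## References

* I. Montvay, G. Münster, *Quantum Fields on a Lattice* (1994), §3.7.1 item 3. [MontvayMunster1994]
* M. P. Forsström, J. Lenells, F. Viklund, AIHP 58 (2022), Thm. 1.1 (leading-order perimeter
  asymptotics of `ℤ_n` Wilson loops). [ForsstromLenellsViklund2022]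
* R. Marra, S. Miracle-Solé, Comm. Math. Phys. 67 (1979) 233–240. [MarraMiraclesole1979]
-/

noncomputable section

open Finset Function Filter MeasureTheory
open scoped Topology
open Literature.MathematicalPhysics.QuantumLattice
open Literature.Probability.LatticeModels (Torus.proj Torus.proj_apply IsPolymerCluster KPTouches GeomInc
  IsRConnected truncatedWeight)

namespace Literature.MathematicalPhysics.QuantumFieldTheory

namespace LatticeForm

variable {d L : ℕ} [NeZero L] {A : Type*} [AddCommGroup A]

/-! ### Circular distance versus canonical lifts -/

/-- The circular distance is at most the distance of the canonical representatives. [folklore] -/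
theorem cdist_le_val_dist (a b : ZMod L) : cdist a b ≤ max (a.val - b.val) (b.val - a.val) := by
  unfold cdist
  rcases le_or_gt b.val a.val with h | h
  · rw [ZMod.val_sub h]
    exact (min_le_left _ _).trans (le_max_left _ _)
  · have hba : (b - a).val = b.val - a.val := ZMod.val_sub h.le
    have hne : b - a ≠ 0 := by
      intro h0
      rw [h0, ZMod.val_zero] at hba
      omega
    have hneg : (a - b).val = L - (b - a).val := by
      rw [show a - b = -(b - a) by ring, ZMod.neg_val, if_neg hne]
    have hlt : (b - a).val < L := ZMod.val_lt _
    have : L - (a - b).val = b.val - a.val := by rw [hneg, hba]; omega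
    calc min (a - b).val (L - (a - b).val) ≤ L - (a - b).val := min_le_right _ _
      _ = b.val - a.val := this
      _ ≤ _ := le_max_right _ _

omit [NeZero L] in
/-- The circular distance is translation invariant. [folklore] -/
theorem cdist_sub_sub (a b c : ZMod L) : cdist (a - c) (b - c) = cdist a b := by
  unfold cdist; rw [sub_sub_sub_cancel_right]

/-! ### Discrete intermediate values for level functions Lipschitz on a set -/

omit [NeZero L] in
/-- Along a chain inside `K`, a level function which is `1`-Lipschitz on adjacent pairs of `K`
attains every intermediate value. [folklore] -/
theorem exists_level_eq_of_reflTransGen_on {K : Finset (Plaquette d L)} (lev : Plaquette d L → ℕ)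
    (hlip : ∀ a b : Plaquette d L, a ∈ K → b ∈ K → CubeAdj a b → lev b ≤ lev a + 1 ∧ lev a ≤ lev b + 1)
    {v w : Plaquette d L} (hv : v ∈ K)
    (h : Relation.ReflTransGen (fun a b => CubeAdj a b ∧ a ∈ K ∧ b ∈ K) v w) :
    ∀ n : ℕ, min (lev v) (lev w) ≤ n → n ≤ max (lev v) (lev w) → ∃ p ∈ K, lev p = n := by
  induction h with
  | refl => intro n h1 h2; exact ⟨v, hv, by omega⟩
  | @tail b c _ hbc ih =>
    intro n h1 h2
    by_cases hold : min (lev v) (lev b) ≤ n ∧ n ≤ max (lev v) (lev b)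
    · exact ih n hold.1 hold.2
    · have := hlip b c hbc.2.1 hbc.2.2 hbc.1
      exact ⟨c, hbc.2.2, by omega⟩

omit [NeZero L] in
/-- The level span along a chain inside `K` is less than `#K`. [folklore] -/
theorem level_span_le_card_on {K : Finset (Plaquette d L)} (lev : Plaquette d L → ℕ)
    (hlip : ∀ a b : Plaquette d L, a ∈ K → b ∈ K → CubeAdj a b → lev b ≤ lev a + 1 ∧ lev a ≤ lev b + 1)
    {v w : Plaquette d L} (hv : v ∈ K)
    (h : Relation.ReflTransGen (fun a b => CubeAdj a b ∧ a ∈ K ∧ b ∈ K) v w) :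
    max (lev v) (lev w) + 1 ≤ K.card + min (lev v) (lev w) := by
  classical
  have hsub : Finset.Icc (min (lev v) (lev w)) (max (lev v) (lev w)) ⊆ K.image lev := by
    intro n hn
    rw [Finset.mem_Icc] at hn
    obtain ⟨p, hp, hpn⟩ := exists_level_eq_of_reflTransGen_on lev hlip hv h n hn.1 hn.2
    exact Finset.mem_image.2 ⟨p, hp, hpn⟩
  have hcard := (Finset.card_le_card hsub).trans Finset.card_image_le
  rw [Nat.card_Icc] at hcard
  omega

/-! ### Small connected closed vortices are exact, with support control -/

/-- The shifted canonical coordinate `(p.1 m - v m).val` of a plaquette. [folklore] -/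
def slev (v : Site d L) (m : Fin d) (p : Plaquette d L) : ℕ := (p.1 m - v m).val

/-- If the shifted coordinates of two cube-adjacent plaquettes avoid the seam, their shifted
canonical coordinates differ by at most one. [folklore] -/
theorem slev_lipschitz {v : Site d L} {m : Fin d} {p q : Plaquette d L}
    (hp : 1 ≤ (slev v m p : ℤ) ∧ (slev v m p : ℤ) ≤ (L : ℤ) - 2)
    (hq : 1 ≤ (slev v m q : ℤ) ∧ (slev v m q : ℤ) ≤ (L : ℤ) - 2) (h : CubeAdj p q) :
    slev v m q ≤ slev v m p + 1 ∧ slev v m p ≤ slev v m q + 1 := by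
  unfold slev at *
  rcases h.coord_sub m with h0 | h1 | h2
  · have : q.1 m - v m = p.1 m - v m := by
      have := sub_eq_zero.1 h0
      rw [this]
    rw [this]; omega
  · have hq' : q.1 m - v m = (p.1 m - v m) + 1 := by linear_combination h1
    rw [hq', val_add_one] at hq ⊢
    have hlt : (p.1 m - v m).val + 1 < L := by omega
    rw [Nat.mod_eq_of_lt hlt] at hq ⊢
    omega
  · have hp' : p.1 m - v m = (q.1 m - v m) + 1 := by linear_combination -h2
    rw [hp', val_add_one] at hp ⊢
    have hlt : (q.1 m - v m).val + 1 < L := by omega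
    rw [Nat.mod_eq_of_lt hlt] at hp ⊢
    omega

/-- **Torus Poincaré lemma with support control for one small vortex.** Let `X` be a cube-connected
set of plaquettes with `2 #X < L` and `η` a closed configuration supported exactly on `X`
(`d ≥ 3`). Then `ext η = td₁ θ` with a `1`-cochain `θ` supported within circular distance `#X`
(in every coordinate) of every plaquette of `X`: after translating `X` away from the seam its
canonical coordinates span at most `#X - 1` in every direction (cube connectivity), and
`exists_td₁_eq_of_liftBox` produces a primitive supported in that bounding box.
[cite: ForsstromLenellsViklund2022, §2.3.3 (Lemma 2.2)] -/
theorem exists_td₁_eq_ext_of_connected_small [Fintype A] [DecidableEq A] (hd : 3 ≤ d)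
    {X : Finset (Plaquette d L)} (hX : IsRConnected CubeAdj X) (hsmall : 2 * X.card < L)
    {η : Plaquette d L → A} (hη : η ∈ Fib X) :
    ∃ θ : Site d L → Fin d → A, td₁ θ = ext η ∧
      ∀ y k, θ y k ≠ 0 → ∀ q ∈ X, ∀ m, cdist (y m) (q.1 m) ≤ X.card := by
  classical
  rw [mem_Fib] at hη
  obtain ⟨hcl, hsupp⟩ := hη
  -- translate the base points away from the seam
  set S : Finset (Site d L) := X.image Prod.fst with hS
  have hScard : 2 * S.card < L := lt_of_le_of_lt (Nat.mul_le_mul_left 2 Finset.card_image_le) hsmall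
  obtain ⟨v, hv⟩ := exists_shift_away S hScard
  have hvX : ∀ q ∈ X, ∀ m, 1 ≤ (slev v m q : ℤ) ∧ (slev v m q : ℤ) ≤ (L : ℤ) - 2 := by
    intro q hq m
    have h := hv q.1 (Finset.mem_image.2 ⟨q, hq, rfl⟩) m
    exact val_mem_of_ne h.1 h.2
  -- the bounding box of the shifted canonical coordinates
  obtain ⟨p₀, hp₀⟩ := hX.1
  have hne : ∀ m, (X.image (slev v m)).Nonempty := fun m => ⟨_, Finset.mem_image.2 ⟨p₀, hp₀, rfl⟩⟩
  set a : Literature.Probability.LatticeModels.Site d := fun m => ((X.image (slev v m)).min' (hne m) : ℤ)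
    with ha
  set b : Literature.Probability.LatticeModels.Site d := fun m => ((X.image (slev v m)).max' (hne m) : ℤ)
    with hb
  have hmin_mem : ∀ m, ∃ q ∈ X, slev v m q = (X.image (slev v m)).min' (hne m) := fun m => by
    have := Finset.min'_mem _ (hne m)
    obtain ⟨q, hq, h⟩ := Finset.mem_image.1 this
    exact ⟨q, hq, h⟩
  have hmax_mem : ∀ m, ∃ q ∈ X, slev v m q = (X.image (slev v m)).max' (hne m) := fun m => by
    have := Finset.max'_mem _ (hne m)
    obtain ⟨q, hq, h⟩ := Finset.mem_image.1 this
    exact ⟨q, hq, h⟩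
  have hle_max : ∀ m, ∀ q ∈ X, slev v m q ≤ (X.image (slev v m)).max' (hne m) := fun m q hq =>
    Finset.le_max' _ _ (Finset.mem_image.2 ⟨q, hq, rfl⟩)
  have hmin_le : ∀ m, ∀ q ∈ X, (X.image (slev v m)).min' (hne m) ≤ slev v m q := fun m q hq =>
    Finset.min'_le _ _ (Finset.mem_image.2 ⟨q, hq, rfl⟩)
  -- the span of the box is less than `#X`
  have hspan : ∀ m, (X.image (slev v m)).max' (hne m) + 1 ≤ X.card + (X.image (slev v m)).min' (hne m) := by
    intro m
    obtain ⟨q₀, hq₀, h₀⟩ := hmin_mem m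
    obtain ⟨q₁, hq₁, h₁⟩ := hmax_mem m
    have hchain := hX.2 q₀ hq₀ q₁ hq₁
    have hsp := level_span_le_card_on (slev v m) (fun a' b' ha' hb' hab =>
      slev_lipschitz (hvX a' ha' m) (hvX b' hb' m) hab) hq₀ hchain
    rw [h₀, h₁] at hsp
    have e1 : max ((X.image (slev v m)).min' (hne m)) ((X.image (slev v m)).max' (hne m)) =
        (X.image (slev v m)).max' (hne m) := max_eq_right (Finset.min'_le_max' _ (hne m))
    have e2 : min ((X.image (slev v m)).min' (hne m)) ((X.image (slev v m)).max' (hne m)) =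
        (X.image (slev v m)).min' (hne m) := min_eq_left (Finset.min'_le_max' _ (hne m))
    rw [e1, e2] at hsp
    exact hsp
  -- the translated cochain and its box
  set ω := shiftCochain₂ v (ext η) with hω
  have hωalt : IsAlt ω := (isAlt_ext η).shiftCochain₂ v
  have hωcl : ∀ y i j k, td₂ ω y i j k = 0 := fun y i j k => by
    rw [hω, td₂_shiftCochain₂]; exact hcl _ i j k
  have hbox : LiftBox ω a b := by
    refine ⟨fun m => ?_, fun m => ?_, fun y i j hy => ?_⟩
    · obtain ⟨q, hq, h⟩ := hmin_mem m
      show (1 : ℤ) ≤ ((X.image (slev v m)).min' (hne m) : ℤ)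
      rw [← h]; exact (hvX q hq m).1
    · obtain ⟨q, hq, h⟩ := hmax_mem m
      show ((X.image (slev v m)).max' (hne m) : ℤ) ≤ (L : ℤ) - 2
      rw [← h]; exact (hvX q hq m).2
    · obtain ⟨p, hp, hp1⟩ := exists_mem_psupp_of_ext_ne_zero hy
      rw [hsupp] at hp
      have hy' : y = p.1 - v := by rw [hp1]; abel
      have hlift : ∀ m, torusSiteLift y m = (slev v m p : ℤ) := fun m => by
        simp only [torusSiteLift, slev, hy', Pi.sub_apply]
      refine ⟨fun m => ?_, fun m => ?_⟩
      · show ((X.image (slev v m)).min' (hne m) : ℤ) ≤ torusSiteLift y m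
        rw [hlift m]; exact_mod_cast hmin_le m p hp
      · show torusSiteLift y m ≤ ((X.image (slev v m)).max' (hne m) : ℤ)
        rw [hlift m]; exact_mod_cast hle_max m p hp
  obtain ⟨θ', hθ', hsupp'⟩ := exists_td₁_eq_of_liftBox hd hωalt hωcl hbox
  refine ⟨shiftCochain₁ (-v) θ', ?_, fun y k hyk q hq m => ?_⟩
  · rw [td₁_shiftCochain₁, hθ', hω, shiftCochain₂_neg_shiftCochain₂]
  · -- support control
    have hyk' : θ' (y + -v) k ≠ 0 := hyk
    have hmem := hsupp' (y + -v) k hyk'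
    have hlo : ((X.image (slev v m)).min' (hne m) : ℤ) ≤ (((y + -v) m).val : ℤ) := hmem.1 m
    have hhi : (((y + -v) m).val : ℤ) ≤ ((X.image (slev v m)).max' (hne m) : ℤ) := hmem.2 m
    have hq1 := hmin_le m q hq
    have hq2 := hle_max m q hq
    have hsp := hspan m
    have e : (y + -v) m = y m - v m := by simp [sub_eq_add_neg]
    rw [e] at hlo hhi
    calc cdist (y m) (q.1 m) = cdist (y m - v m) (q.1 m - v m) := (cdist_sub_sub _ _ _).symm
      _ ≤ max ((y m - v m).val - (q.1 m - v m).val) ((q.1 m - v m).val - (y m - v m).val) :=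
          cdist_le_val_dist _ _
      _ ≤ X.card := by
          have hq1' : (X.image (slev v m)).min' (hne m) ≤ (q.1 m - v m).val := hq1
          have hq2' : (q.1 m - v m).val ≤ (X.image (slev v m)).max' (hne m) := hq2
          have hlo' : (X.image (slev v m)).min' (hne m) ≤ (y m - v m).val := by exact_mod_cast hlo
          have hhi' : (y m - v m).val ≤ (X.image (slev v m)).max' (hne m) := by exact_mod_cast hhi
          clear hq1 hq2 hlo hhi
          refine max_le ?_ ?_ <;> omega

end LatticeForm

/-! ### Rectangles: plaquettes, boundary sites, total flux, Stokes -/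

namespace LatticeForm

variable {d L : ℕ} [NeZero L] {A : Type*} [AddCommGroup A]

/-- The base point `a eᵢ + b eⱼ` of a plaquette of the rectangle at the origin. [folklore] -/
def rectBase (i j : Fin d) (a b : ℕ) : Site d L := (a : ZMod L) • te i + (b : ZMod L) • te j

/-- The plaquettes of the `R × T` rectangle at the origin in the `(i, j)` plane. [folklore] -/
def rectPlaq {i j : Fin d} (hij : i < j) (R T : ℕ) : Finset (Plaquette d L) :=
  (Finset.range R ×ˢ Finset.range T).image fun ab => (rectBase i j ab.1 ab.2, ⟨(i, j), hij⟩)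

/-- The base points of the boundary edges of the rectangle. [folklore] -/
def rectBoundary (i j : Fin d) (R T : ℕ) : Finset (Site d L) :=
  (Finset.range R).image (fun a => rectBase i j a 0) ∪ (Finset.range T).image (fun b => rectBase i j R b) ∪
    (Finset.range R).image (fun a => rectBase i j a T) ∪ (Finset.range T).image (fun b => rectBase i j 0 b)

omit [NeZero L] in
/-- The rectangle has at most `2(R+T)` boundary sites. [folklore] -/
theorem card_rectBoundary_le (i j : Fin d) (R T : ℕ) :
    (rectBoundary (L := L) i j R T).card ≤ 2 * (R + T) := by
  unfold rectBoundary
  set s1 := (Finset.range R).image (fun a => (rectBase i j a 0 : Site d L)) with hs1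
  set s2 := (Finset.range T).image (fun b => (rectBase i j R b : Site d L)) with hs2
  set s3 := (Finset.range R).image (fun a => (rectBase i j a T : Site d L)) with hs3
  set s4 := (Finset.range T).image (fun b => (rectBase i j 0 b : Site d L)) with hs4
  have h1 : s1.card ≤ R := Finset.card_image_le.trans (by rw [Finset.card_range])
  have h2 : s2.card ≤ T := Finset.card_image_le.trans (by rw [Finset.card_range])
  have h3 : s3.card ≤ R := Finset.card_image_le.trans (by rw [Finset.card_range])
  have h4 : s4.card ≤ T := Finset.card_image_le.trans (by rw [Finset.card_range])
  have u1 := Finset.card_union_le (s1 ∪ s2 ∪ s3) s4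
  have u2 := Finset.card_union_le (s1 ∪ s2) s3
  have u3 := Finset.card_union_le s1 s2
  omega

/-- The total flux through the rectangle. [folklore] -/
def rectFlux {i j : Fin d} (hij : i < j) (R T : ℕ) (η : Plaquette d L → A) : A :=
  ∑ b ∈ Finset.range T, ∑ a ∈ Finset.range R, η (rectBase i j a b, ⟨(i, j), hij⟩)

omit [NeZero L] in
/-- **Stokes**: the total flux of `td₁ θ` through the rectangle vanishes when `θ` vanishes at
all boundary sites. [folklore] -/
theorem rectFlux_eq_zero_of_td₁ {i j : Fin d} (hij : i < j) (R T : ℕ) {η : Plaquette d L → A}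
    {θ : Site d L → Fin d → A} (hθ : td₁ θ = ext η)
    (hvan : ∀ y ∈ rectBoundary i j R T, ∀ k, θ y k = 0) : rectFlux hij R T η = 0 := by
  have hflux : rectFlux hij R T η = ∑ b ∈ Finset.range T, ∑ a ∈ Finset.range R,
      td₁ θ ((0 : Site d L) + (a : ZMod L) • te i + (b : ZMod L) • te j) i j := by
    unfold rectFlux
    refine Finset.sum_congr rfl fun b _ => Finset.sum_congr rfl fun a _ => ?_
    rw [hθ, ext_apply_of_lt η _ hij, zero_add]
    rfl
  rw [hflux, ← lineSum_rect_eq_sum_td₁, lineSum_eq_sum, lineSum_eq_sum, lineSum_eq_sum, lineSum_eq_sum]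
  have z1 : ∑ a ∈ Finset.range R, θ ((0 : Site d L) + (a : ZMod L) • te i) i = 0 :=
    Finset.sum_eq_zero fun a ha => hvan _ (by
      unfold rectBoundary rectBase
      simp only [Finset.mem_union, Finset.mem_image, Finset.mem_range]
      exact Or.inl (Or.inl (Or.inl ⟨a, Finset.mem_range.1 ha, by simp⟩))) i
  have z2 : ∑ b ∈ Finset.range T, θ ((0 : Site d L) + (R : ZMod L) • te i + (b : ZMod L) • te j) j = 0 :=
    Finset.sum_eq_zero fun b hb => hvan _ (by
      unfold rectBoundary rectBase
      simp only [Finset.mem_union, Finset.mem_image, Finset.mem_range]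
      exact Or.inl (Or.inl (Or.inr ⟨b, Finset.mem_range.1 hb, by simp⟩))) j
  have z3 : ∑ a ∈ Finset.range R, θ ((0 : Site d L) + (T : ZMod L) • te j + (a : ZMod L) • te i) i = 0 :=
    Finset.sum_eq_zero fun a ha => hvan _ (by
      unfold rectBoundary rectBase
      simp only [Finset.mem_union, Finset.mem_image, Finset.mem_range]
      exact Or.inl (Or.inr ⟨a, Finset.mem_range.1 ha, by rw [zero_add, add_comm]⟩)) i
  have z4 : ∑ b ∈ Finset.range T, θ ((0 : Site d L) + (b : ZMod L) • te j) j = 0 :=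
    Finset.sum_eq_zero fun b hb => hvan _ (by
      unfold rectBoundary rectBase
      simp only [Finset.mem_union, Finset.mem_image, Finset.mem_range]
      exact Or.inr ⟨b, Finset.mem_range.1 hb, by simp⟩) j
  rw [z1, z2, z3, z4]; abel

/-- A plaquette set is *far from the boundary* of the rectangle: every plaquette of it is at
circular distance more than `#X`, in some coordinate, from every boundary site. [folklore] -/
def FarFrom (X : Finset (Plaquette d L)) (Bd : Finset (Site d L)) : Prop :=
  ∀ q ∈ X, ∀ y ∈ Bd, ∃ m, X.card < cdist (y m) (q.1 m)

/-- **Small vortices far from the boundary carry no flux through the rectangle.** [folklore] -/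
theorem rectFlux_eq_zero_of_far [Fintype A] [DecidableEq A] (hd : 3 ≤ d) {i j : Fin d} (hij : i < j)
    (R T : ℕ) {X : Finset (Plaquette d L)} (hX : IsRConnected CubeAdj X) (hsmall : 2 * X.card < L)
    (hfar : FarFrom X (rectBoundary i j R T)) {η : Plaquette d L → A} (hη : η ∈ Fib X) :
    rectFlux hij R T η = 0 := by
  obtain ⟨θ, hθ, hsupp⟩ := exists_td₁_eq_ext_of_connected_small hd hX hsmall hη
  refine rectFlux_eq_zero_of_td₁ hij R T hθ fun y hy k => ?_
  by_contra hne
  obtain ⟨q, hq⟩ := hX.1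
  obtain ⟨m, hm⟩ := hfar q hq y hy
  have := hsupp y k hne q hq m
  omega

end LatticeForm

/-! ### The Wilson loop as a multiplicative observable of the plaquette field -/

section LoopObs

open LatticeForm

variable {d L : ℕ} [NeZero L] {G : Type*} [CommGroup G] [Fintype G] [DecidableEq G]

/-- The interpolated loop observable `ψ_s(η) = ∏_{p ∈ R×T} (s χ(η_p) + (1-s))` of a character
`χ` (`s = 1`: the character of the total flux, i.e. of the loop holonomy). [folklore] -/
def loopObs (χ : G →* ℂ) (s : ℝ) {i j : Fin d} (hij : i < j) (R T : ℕ)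
    (η : Plaquette d L → Additive G) : ℂ :=
  ∏ b ∈ Finset.range T, ∏ a ∈ Finset.range R,
    ((s : ℂ) * χ (Additive.toMul (η (rectBase i j a b, ⟨(i, j), hij⟩))) + (1 - s))

omit [NeZero L] [Fintype G] [DecidableEq G] in
/-- At `s = 1` the loop observable is the character of the total flux. [folklore] -/
theorem loopObs_one (χ : G →* ℂ) {i j : Fin d} (hij : i < j) (R T : ℕ) (η : Plaquette d L → Additive G) :
    loopObs χ 1 hij R T η = χ (Additive.toMul (rectFlux hij R T η)) := by
  unfold loopObs rectFlux
  simp only [Complex.ofReal_one, one_mul, sub_self, add_zero, toMul_sum, map_prod]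

omit [Fintype G] in
/-- The loop observable is multiplicative over configurations with disjoint supports. [folklore] -/
theorem isMultObs_loopObs (χ : G →* ℂ) (s : ℝ) {i j : Fin d} (hij : i < j) (R T : ℕ) :
    IsMultObs (loopObs (L := L) χ s hij R T) := by
  refine ⟨?_, fun η₁ η₂ hdis => ?_⟩
  · unfold loopObs; simp
  · unfold loopObs
    rw [← Finset.prod_mul_distrib]
    refine Finset.prod_congr rfl fun b _ => ?_
    rw [← Finset.prod_mul_distrib]
    refine Finset.prod_congr rfl fun a _ => ?_
    set p : Plaquette d L := (rectBase i j a b, ⟨(i, j), hij⟩)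
    have hz : η₁ p = 0 ∨ η₂ p = 0 := by
      by_contra h
      push Not at h
      exact Finset.disjoint_left.1 hdis (mem_psupp.2 h.1) (mem_psupp.2 h.2)
    rcases hz with h | h
    · rw [Pi.add_apply, h, zero_add]; simp
    · rw [Pi.add_apply, h, add_zero]; simp

omit [Fintype G] in
/-- The loop observable is local on the rectangle. [folklore] -/
theorem isLocalOn_loopObs (χ : G →* ℂ) (s : ℝ) {i j : Fin d} (hij : i < j) (R T : ℕ) :
    IsLocalOn (loopObs (L := L) χ s hij R T) (rectPlaq hij R T) := by
  intro η hη
  unfold loopObs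
  refine Finset.prod_eq_one fun b hb => Finset.prod_eq_one fun a ha => ?_
  have hp : ((rectBase i j a b : Site d L), (⟨(i, j), hij⟩ : {p : Fin d × Fin d // p.1 < p.2})) ∈
      rectPlaq (L := L) hij R T :=
    Finset.mem_image.2 ⟨(a, b), Finset.mem_product.2 ⟨ha, hb⟩, rfl⟩
  have h0 : η (rectBase i j a b, ⟨(i, j), hij⟩) = 0 := by
    by_contra hne
    exact Finset.disjoint_left.1 hη (mem_psupp.2 hne) hp
  rw [h0]; simp

omit [NeZero L] [Fintype G] [DecidableEq G] in
/-- For `s ∈ [0,1]` and a unitary character the loop observable is bounded by `1`. [folklore] -/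
theorem norm_loopObs_le (χ : G →* ℂ) (hχ1 : ∀ g, ‖χ g‖ = 1) {s : ℝ} (hs0 : 0 ≤ s) (hs1 : s ≤ 1)
    {i j : Fin d} (hij : i < j) (R T : ℕ) (η : Plaquette d L → Additive G) :
    ‖loopObs χ s hij R T η‖ ≤ 1 := by
  unfold loopObs
  rw [norm_prod]
  refine Finset.prod_le_one (fun _ _ => norm_nonneg _) fun b _ => ?_
  rw [norm_prod]
  refine Finset.prod_le_one (fun _ _ => norm_nonneg _) fun a _ => ?_
  calc ‖(s : ℂ) * χ (Additive.toMul (η (rectBase i j a b, ⟨(i, j), hij⟩))) + (1 - s)‖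
      ≤ ‖(s : ℂ) * χ (Additive.toMul (η (rectBase i j a b, ⟨(i, j), hij⟩)))‖ + ‖(1 - s : ℂ)‖ := norm_add_le _ _
    _ = s + (1 - s) := by
        rw [norm_mul, hχ1, mul_one, Complex.norm_real, Real.norm_eq_abs, abs_of_nonneg hs0,
          show (1 - s : ℂ) = ((1 - s : ℝ) : ℂ) by push_cast; ring, Complex.norm_real, Real.norm_eq_abs,
          abs_of_nonneg (by linarith)]
    _ = 1 := by ring

/-- **Vortices far from the boundary do not see the loop**: for a small cube-connected `X` far
from the boundary, the activity dressed by the loop character equals the undressed one.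
[cite: MontvayMunster1994, §3.7.1 item 3 (Peierls argument for the Wilson loop)] -/
theorem act_loopObs_eq_of_far (hd : 3 ≤ d) (φ : Additive G → ℝ) (χ : G →* ℂ) {i j : Fin d} (hij : i < j)
    (R T : ℕ) {X : Finset (Plaquette d L)} (hX : IsRConnected CubeAdj X) (hsmall : 2 * X.card < L)
    (hfar : FarFrom X (rectBoundary i j R T)) :
    act φ (loopObs χ 1 hij R T) X = act φ (fun _ : Plaquette d L → Additive G => (1 : ℂ)) X := by
  classical
  unfold act
  rw [if_pos hX, if_pos hX]
  refine Finset.sum_congr rfl fun η hη => ?_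
  rw [loopObs_one, rectFlux_eq_zero_of_far hd hij R T hX hsmall hfar hη, toMul_zero, map_one]

end LoopObs

/-! ### The cluster sum of a dressed observable is controlled by the bad polymers -/

namespace LatticeForm

namespace KPRegime

variable {d L : ℕ} [NeZero L] {A : Type*} [AddCommGroup A] [Fintype A] [DecidableEq A]
  {φ : A → ℝ} {ε τ : ℝ}

/-- **Clusters through a given polymer** (estimate (4) with `σ = X`, `d = τ #·`):
`∑_{C ∋ X} ‖Φ^T(C; act φ ψ)‖ ≤ #X e^{-τ #X}`. [cite: KoteckyPreiss1986, Theorem p. 492, estimate (4)] -/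
theorem sum_containing_norm_le (h : KPRegime d A φ ε τ) {ψ : (Plaquette d L → A) → ℂ} (hψ : ∀ η, ‖ψ η‖ ≤ 1)
    (X : Finset (Plaquette d L)) :
    ∑ C ∈ ((connSets d L).powerset).filter (fun C => X ∈ C),
        ‖truncatedWeight (GeomInc CubeAdj) (act φ ψ) C‖ ≤ X.card * Real.exp (-(τ * X.card)) := by
  classical
  set CC := ((connSets d L).powerset).filter (fun C => X ∈ C) with hCC
  have hall : ∀ C ∈ CC, KPTouches (GeomInc CubeAdj) C X := fun C hC =>
    ⟨X, (Finset.mem_filter.1 hC).2, Or.inl rfl⟩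
  have hfilt : CC.filter (fun C => KPTouches (GeomInc CubeAdj) C X) = CC := Finset.filter_true_of_mem hall
  have key := h.sum_touches_norm_le_exp_neg hψ CC X (D := X.card) (fun C hC _ => by
    have hX : X ∈ C := (Finset.mem_filter.1 hC).2
    have := Finset.single_le_sum (f := fun Y : Finset (Plaquette d L) => (Y.card : ℝ))
      (fun _ _ => Nat.cast_nonneg _) hX
    exact this)
  rw [hfilt] at key
  linarith [key]

/-- **The cluster sum is carried by the bad polymers.** If the dressed and undressed activities
agree on all *good* connected polymers, then
`‖∑_C dPhi ψ C‖ ≤ 2 ∑_{X bad} #X e^{-τ #X}`. [cite: KoteckyPreiss1986, Theorem p. 492, estimate (4)] -/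
theorem norm_sum_dPhi_le_of_good (h : KPRegime d A φ ε τ) {ψ : (Plaquette d L → A) → ℂ}
    (hψ : ∀ η, ‖ψ η‖ ≤ 1) (Good : Finset (Plaquette d L) → Prop) [DecidablePred Good]
    (hgood : ∀ X ∈ connSets d L, Good X → act φ ψ X = act φ (fun _ : Plaquette d L → A => (1 : ℂ)) X) :
    ‖∑ C ∈ (connSets d L).powerset, dPhi φ ψ C‖ ≤
      2 * ∑ X ∈ (connSets d L).filter (fun X => ¬ Good X), (X.card : ℝ) * Real.exp (-(τ * X.card)) := by
  classical
  set PP := (connSets d L).powerset with hPP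
  have hone : ∀ η : Plaquette d L → A, ‖(fun _ : Plaquette d L → A => (1 : ℂ)) η‖ ≤ 1 := fun _ => by simp
  -- clusters without bad polymers do not contribute
  have hzero : ∀ C ∈ PP, (¬ ∃ X ∈ C, ¬ Good X) → dPhi φ ψ C = 0 := by
    intro C hC hno
    push Not at hno
    rw [dPhi, Literature.Probability.LatticeModels.truncatedWeight_congr (fun X hX =>
      hgood X (Finset.mem_powerset.1 hC hX) (hno X hX)), sub_self]
  have step1 : ∑ C ∈ PP, dPhi φ ψ C = ∑ C ∈ PP, (if ∃ X ∈ C, ¬ Good X then dPhi φ ψ C else 0) :=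
    Finset.sum_congr rfl fun C hC => by
      split_ifs with hex
      · rfl
      · exact hzero C hC hex
  rw [step1]
  refine (norm_sum_ite_le PP _ _).trans ?_
  -- the indicator of "some bad polymer" is at most the number of bad polymers
  have step3 : ∀ C ∈ PP, (if ∃ X ∈ C, ¬ Good X then ‖dPhi φ ψ C‖ else 0) ≤
      ∑ X ∈ C, (if ¬ Good X then ‖dPhi φ ψ C‖ else 0) := by
    intro C _
    split_ifs with hex
    · obtain ⟨X₀, hX₀, hbad⟩ := hex
      have := Finset.single_le_sum (f := fun X => if ¬ Good X then ‖dPhi φ ψ C‖ else 0)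
        (fun X _ => by split_ifs <;> simp) hX₀
      simp only [hbad, not_false_eq_true, if_true] at this
      exact this
    · exact Finset.sum_nonneg fun X _ => by split_ifs <;> simp
  refine (Finset.sum_le_sum step3).trans ?_
  -- exchange the sums
  rw [Finset.sum_comm' (t' := connSets d L) (s' := fun X => PP.filter fun C => X ∈ C) (fun C X => by
    simp only [hPP, Finset.mem_filter, Finset.mem_powerset]
    constructor
    · rintro ⟨hC, hX⟩; exact ⟨⟨hC, hX⟩, hC hX⟩
    · rintro ⟨⟨hC, hX⟩, -⟩; exact ⟨hC, hX⟩)]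
  rw [Finset.mul_sum, ← Finset.sum_filter_add_sum_filter_not (connSets d L) (fun X => ¬ Good X)]
  have hgoodpart : ∑ X ∈ (connSets d L).filter (fun X => ¬¬ Good X),
      ∑ C ∈ PP.filter (fun C => X ∈ C), (if ¬ Good X then ‖dPhi φ ψ C‖ else 0) = 0 :=
    Finset.sum_eq_zero fun X hX => Finset.sum_eq_zero fun C _ => by
      have : Good X := not_not.1 (Finset.mem_filter.1 hX).2
      simp [this]
  rw [hgoodpart, add_zero]
  refine Finset.sum_le_sum fun X hX => ?_
  have hbad : ¬ Good X := (Finset.mem_filter.1 hX).2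
  simp only [hbad, not_false_eq_true, if_true]
  calc ∑ C ∈ PP.filter (fun C => X ∈ C), ‖dPhi φ ψ C‖
      ≤ ∑ C ∈ PP.filter (fun C => X ∈ C), (‖truncatedWeight (GeomInc CubeAdj) (act φ ψ) C‖ +
          ‖truncatedWeight (GeomInc CubeAdj) (act φ fun _ : Plaquette d L → A => (1 : ℂ)) C‖) :=
        Finset.sum_le_sum fun C _ => norm_dPhi_le φ ψ C
    _ ≤ X.card * Real.exp (-(τ * X.card)) + X.card * Real.exp (-(τ * X.card)) := by
        rw [Finset.sum_add_distrib]
        exact add_le_add (h.sum_containing_norm_le hψ X) (h.sum_containing_norm_le hone X)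
    _ = 2 * (X.card * Real.exp (-(τ * X.card))) := by ring

end KPRegime

/-! ### Counting the bad polymers near a set of sites -/

variable {d L : ℕ} [NeZero L]

/-- `m ≤ 2^m` in `ℝ`. [folklore] -/
theorem natCast_le_two_pow (m : ℕ) : (m : ℝ) ≤ 2 ^ m := by exact_mod_cast (Nat.lt_two_pow_self).le

omit [NeZero L] in
/-- `#X e^{-τ #X} ≤ (2 e^{-τ})^{#X}`. [folklore] -/
theorem card_mul_exp_le (τ : ℝ) (X : Finset (Plaquette d L)) :
    (X.card : ℝ) * Real.exp (-(τ * X.card)) ≤ (2 * Real.exp (-τ)) ^ X.card := by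
  rw [mul_pow, show -(τ * X.card) = (X.card : ℕ) * (-τ) by ring, Real.exp_nat_mul]
  exact mul_le_mul_of_nonneg_right (natCast_le_two_pow _) (pow_nonneg (Real.exp_nonneg _) _)

/-- The circular sup-distance of a plaquette's base point from a site. [folklore] -/
def maxdist (y : Site d L) (q : Plaquette d L) : ℕ := Finset.univ.sup fun m => cdist (y m) (q.1 m)

omit [NeZero L] in
/-- `maxdist ≤ D` iff all coordinate distances are `≤ D`. [folklore] -/
theorem maxdist_le_iff {y : Site d L} {q : Plaquette d L} {D : ℕ} :
    maxdist y q ≤ D ↔ ∀ m, cdist (y m) (q.1 m) ≤ D := by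
  unfold maxdist
  rw [Finset.sup_le_iff]
  simp

/-- The sites within circular distance `D` of `y` in every coordinate are translates of `y` by
integer vectors in `[-D, D]^d`. [folklore] -/
theorem mem_image_of_cdist_le (y z : Site d L) {D : ℕ} (h : ∀ m, cdist (y m) (z m) ≤ D) :
    z ∈ (Fintype.piFinset fun _ : Fin d => Finset.Icc (-(D : ℤ)) D).image
      (fun t : Fin d → ℤ => fun m => y m + ((t m : ℤ) : ZMod L)) := by
  classical
  -- coordinatewise choice of the integer offset
  have hcoord : ∀ m, ∃ t : ℤ, -(D : ℤ) ≤ t ∧ t ≤ D ∧ y m + (t : ZMod L) = z m := by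
    intro m
    have hm := h m
    unfold cdist at hm
    set u := (y m - z m).val with hu
    have hcast : ((u : ℕ) : ZMod L) = y m - z m := by rw [hu, ZMod.natCast_zmod_val]
    rcases le_or_gt u (L - u) with hle | hgt
    · rw [min_eq_left hle] at hm
      refine ⟨-(u : ℤ), by omega, by omega, ?_⟩
      rw [Int.cast_neg, Int.cast_natCast, hcast]; ring
    · rw [min_eq_right hgt.le] at hm
      have huL : u ≤ L := (ZMod.val_lt _).le
      refine ⟨((L - u : ℕ) : ℤ), by omega, by omega, ?_⟩
      rw [Int.cast_natCast, Nat.cast_sub huL, ZMod.natCast_self, zero_sub, hcast]; ring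
  choose t ht using hcoord
  refine Finset.mem_image.2 ⟨t, Fintype.mem_piFinset.2 fun m => Finset.mem_Icc.2 ⟨(ht m).1, (ht m).2.1⟩, ?_⟩
  funext m
  exact (ht m).2.2

/-- At most `(2D+1)^d · #planes` plaquettes lie within circular sup-distance `D` of a site.
[folklore] -/
theorem card_filter_maxdist_le (y : Site d L) (D : ℕ) :
    ((Finset.univ : Finset (Plaquette d L)).filter (fun q => maxdist y q ≤ D)).card ≤
      (2 * D + 1) ^ d * Fintype.card {p : Fin d × Fin d // p.1 < p.2} := by
  classical
  set N := (Fintype.piFinset fun _ : Fin d => Finset.Icc (-(D : ℤ)) D).image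
      (fun t : Fin d → ℤ => fun m => y m + ((t m : ℤ) : ZMod L)) with hN
  have hsub : (Finset.univ : Finset (Plaquette d L)).filter (fun q => maxdist y q ≤ D) ⊆
      N ×ˢ (Finset.univ : Finset {p : Fin d × Fin d // p.1 < p.2}) := by
    intro q hq
    rw [Finset.mem_filter] at hq
    exact Finset.mem_product.2 ⟨mem_image_of_cdist_le y q.1 (maxdist_le_iff.1 hq.2), Finset.mem_univ _⟩
  refine (Finset.card_le_card hsub).trans ?_
  rw [Finset.card_product, Finset.card_univ]
  refine Nat.mul_le_mul_right _ ?_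
  refine Finset.card_image_le.trans ?_
  rw [Fintype.card_piFinset, Finset.prod_const, Finset.card_univ, Fintype.card_fin]
  refine Nat.pow_le_pow_left ?_ _
  rw [Int.card_Icc]
  omega

/-- **Tail of the connected-set series through a plaquette, with an extra geometric factor**: if
`(Δ+1)² (K λ) ≤ 1/2` with `K ≥ 1`, then `∑_{X ∋ q connected, #X ≥ M} λ^{#X} ≤ 2Kλ · K^{-M}`.
[folklore] -/
theorem sum_pow_card_tail_le {lam K : ℝ} (hlam : 0 ≤ lam) (hK : 1 ≤ K)
    (hsmall : ((cubeDeg d : ℝ) + 1) ^ 2 * (K * lam) ≤ 1 / 2) (q : Plaquette d L) (M : ℕ)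
    (S : Finset (Finset (Plaquette d L))) (hS : ∀ X ∈ S, q ∈ X ∧ IsRConnected CubeAdj X ∧ M ≤ X.card) :
    ∑ X ∈ S, lam ^ X.card ≤ 2 * (K * lam) * (K ^ M)⁻¹ := by
  have hK0 : 0 < K := by linarith
  have hΔ : ∀ p : Plaquette d L, (cubeNbr p).card ≤ cubeDeg d := fun p => card_cubeNbr_le p
  have hanimal := Literature.Probability.LatticeModels.sum_pow_card_le_of_connected (R := CubeAdj)
    (nbr := cubeNbr) (Δ := cubeDeg d) (fun _ _ => cubeAdj_symm) hΔ (fun _ _ h => mem_cubeNbr_of_cubeAdj h)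
    (lam := K * lam) (by positivity) hsmall q S (fun X hX => ⟨(hS X hX).1, (hS X hX).2.1⟩)
  calc ∑ X ∈ S, lam ^ X.card ≤ ∑ X ∈ S, (K * lam) ^ X.card * (K ^ M)⁻¹ := by
        refine Finset.sum_le_sum fun X hX => ?_
        have hM := (hS X hX).2.2
        rw [mul_pow, mul_assoc, mul_comm (lam ^ X.card), ← mul_assoc]
        refine le_mul_of_one_le_left (pow_nonneg hlam _) ?_
        rw [le_mul_inv_iff₀ (pow_pos hK0 _), one_mul]
        exact pow_le_pow_right₀ hK hM
    _ = (∑ X ∈ S, (K * lam) ^ X.card) * (K ^ M)⁻¹ := by rw [Finset.sum_mul]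
    _ ≤ 2 * (K * lam) * (K ^ M)⁻¹ := mul_le_mul_of_nonneg_right hanimal (by positivity)

/-- **The polymers near a site have small total weight**: with `K = 2 · 3^d` and
`(Δ+1)² K λ ≤ 1/2`,
`∑_q ∑_{X ∋ q connected, maxdist(y, q) ≤ #X} λ^{#X} ≤ 2Kλ · 2 #planes`. [folklore] -/
theorem sum_near_site_le {lam : ℝ} (hlam : 0 ≤ lam)
    (hsmall : ((cubeDeg d : ℝ) + 1) ^ 2 * ((2 * 3 ^ d) * lam) ≤ 1 / 2) (y : Site d L)
    (Λ : Finset (Finset (Plaquette d L))) (hΛ : ∀ X ∈ Λ, IsRConnected CubeAdj X) :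
    ∑ q : Plaquette d L, ∑ X ∈ Λ.filter (fun X => q ∈ X ∧ maxdist y q ≤ X.card), lam ^ X.card ≤
      2 * ((2 * 3 ^ d) * lam) * (2 * Fintype.card {p : Fin d × Fin d // p.1 < p.2}) := by
  classical
  set K : ℝ := 2 * 3 ^ d with hK
  have hK1 : 1 ≤ K := by
    rw [hK]; have : (1 : ℝ) ≤ 3 ^ d := one_le_pow₀ (by norm_num); linarith
  have hK0 : 0 < K := by linarith
  set Pl : ℝ := (Fintype.card {p : Fin d × Fin d // p.1 < p.2} : ℝ) with hPl
  -- per plaquette: the tail bound at threshold `maxdist y q`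
  have hq : ∀ q : Plaquette d L, ∑ X ∈ Λ.filter (fun X => q ∈ X ∧ maxdist y q ≤ X.card), lam ^ X.card ≤
      2 * (K * lam) * (K ^ maxdist y q)⁻¹ := fun q =>
    sum_pow_card_tail_le hlam hK1 hsmall q (maxdist y q) _ fun X hX => by
      rw [Finset.mem_filter] at hX
      exact ⟨hX.2.1, hΛ X hX.1, hX.2.2⟩
  refine (Finset.sum_le_sum fun q _ => hq q).trans ?_
  rw [← Finset.mul_sum]
  refine mul_le_mul_of_nonneg_left ?_ (by positivity)
  -- `∑_q K^{-maxdist(y,q)} ≤ 2 #planes`: group by the value of `maxdist`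
  have hbound : ∀ q : Plaquette d L, maxdist y q < L + 1 := fun q => by
    unfold maxdist
    have : ∀ m, cdist (y m) (q.1 m) < L + 1 := fun m => by
      unfold cdist; have := ZMod.val_lt (y m - q.1 m); omega
    exact Nat.lt_succ_of_le ((Finset.sup_le fun m _ => Nat.le_of_lt_succ (this m)))
  rw [← Finset.sum_fiberwise_of_maps_to (s := Finset.univ) (t := Finset.range (L + 1))
    (g := fun q => maxdist y q) (fun q _ => Finset.mem_range.2 (hbound q))]
  calc ∑ D ∈ Finset.range (L + 1), ∑ q ∈ (Finset.univ : Finset (Plaquette d L)).filter (fun q => maxdist y q = D),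
        (K ^ maxdist y q)⁻¹
      = ∑ D ∈ Finset.range (L + 1),
          ((Finset.univ : Finset (Plaquette d L)).filter (fun q => maxdist y q = D)).card * (K ^ D)⁻¹ := by
        refine Finset.sum_congr rfl fun D _ => ?_
        rw [Finset.sum_congr rfl fun q hq => by rw [(Finset.mem_filter.1 hq).2], Finset.sum_const, nsmul_eq_mul]
    _ ≤ ∑ D ∈ Finset.range (L + 1), ((2 * D + 1) ^ d * Pl) * (K ^ D)⁻¹ := by
        refine Finset.sum_le_sum fun D _ => mul_le_mul_of_nonneg_right ?_ (by positivity)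
        have h1 : ((Finset.univ : Finset (Plaquette d L)).filter (fun q => maxdist y q = D)).card ≤
            ((Finset.univ : Finset (Plaquette d L)).filter (fun q => maxdist y q ≤ D)).card :=
          Finset.card_le_card (Finset.monotone_filter_right _ fun q _ h => h.le)
        have h2 := card_filter_maxdist_le (L := L) y D
        rw [hPl]; exact_mod_cast h1.trans h2
    _ ≤ ∑ D ∈ Finset.range (L + 1), Pl * (1 / 2) ^ D := by
        refine Finset.sum_le_sum fun D _ => ?_
        have h3 : ((2 * D + 1 : ℕ) : ℝ) ^ d ≤ (3 : ℝ) ^ (d * D) := by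
          calc ((2 * D + 1 : ℕ) : ℝ) ^ d ≤ ((3 : ℝ) ^ D) ^ d := by
                refine pow_le_pow_left₀ (by positivity) ?_ _
                have h3D : ∀ k : ℕ, 2 * k + 1 ≤ 3 ^ k := fun k => by
                  induction k with
                  | zero => simp
                  | succ k ih => rw [pow_succ]; omega
                exact_mod_cast h3D D
            _ = 3 ^ (d * D) := by rw [← pow_mul, mul_comm]
        have hKD : (K ^ D)⁻¹ = ((3 : ℝ) ^ (d * D))⁻¹ * (1 / 2) ^ D := by
          rw [hK, mul_pow, mul_inv, ← pow_mul, one_div, inv_pow]; ring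
        rw [hKD]
        calc ((2 * (D : ℝ) + 1) ^ d * Pl) * (((3 : ℝ) ^ (d * D))⁻¹ * (1 / 2) ^ D)
            = (((2 * D + 1 : ℕ) : ℝ) ^ d * ((3 : ℝ) ^ (d * D))⁻¹) * (Pl * (1 / 2) ^ D) := by push_cast; ring
          _ ≤ 1 * (Pl * (1 / 2) ^ D) := by
              refine mul_le_mul_of_nonneg_right ?_ (by positivity)
              rw [mul_inv_le_iff₀ (by positivity), one_mul]
              exact h3
          _ = Pl * (1 / 2) ^ D := one_mul _
    _ = Pl * ∑ D ∈ Finset.range (L + 1), (1 / 2 : ℝ) ^ D := by rw [Finset.mul_sum]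
    _ ≤ Pl * 2 := mul_le_mul_of_nonneg_left (sum_geometric_two_le _) (by positivity)
    _ = 2 * Pl := mul_comm _ _

/-- **Weight of the polymers that are not far from a set of sites.** [folklore] -/
theorem sum_not_far_le {lam : ℝ} (hlam : 0 ≤ lam)
    (hsmall : ((cubeDeg d : ℝ) + 1) ^ 2 * ((2 * 3 ^ d) * lam) ≤ 1 / 2) (Bd : Finset (Site d L))
    [DecidablePred fun X : Finset (Plaquette d L) => FarFrom X Bd] :
    ∑ X ∈ (connSets d L).filter (fun X => ¬ FarFrom X Bd), lam ^ X.card ≤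
      Bd.card * (2 * ((2 * 3 ^ d) * lam) * (2 * Fintype.card {p : Fin d × Fin d // p.1 < p.2})) := by
  classical
  -- union bound over the witnesses `(y, q)`
  have step : ∀ X ∈ (connSets d L).filter (fun X => ¬ FarFrom X Bd), lam ^ X.card ≤
      ∑ y ∈ Bd, ∑ q : Plaquette d L, (if q ∈ X ∧ maxdist y q ≤ X.card then lam ^ X.card else 0) := by
    intro X hX
    have hnot : ¬ FarFrom X Bd := (Finset.mem_filter.1 hX).2
    unfold FarFrom at hnot
    push Not at hnot
    obtain ⟨q₀, hq₀, y₀, hy₀, hall⟩ := hnot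
    have hmd : maxdist y₀ q₀ ≤ X.card := maxdist_le_iff.2 hall
    have hinner : lam ^ X.card ≤ ∑ q : Plaquette d L, (if q ∈ X ∧ maxdist y₀ q ≤ X.card then lam ^ X.card else 0) := by
      have := Finset.single_le_sum (f := fun q => if q ∈ X ∧ maxdist y₀ q ≤ X.card then lam ^ X.card else 0)
        (fun q _ => by split_ifs <;> positivity) (Finset.mem_univ q₀)
      simp only [hq₀, hmd, and_self, if_true] at this
      exact this
    exact hinner.trans (Finset.single_le_sum (f := fun y => ∑ q : Plaquette d L,
      (if q ∈ X ∧ maxdist y q ≤ X.card then lam ^ X.card else 0))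
      (fun y _ => Finset.sum_nonneg fun q _ => by split_ifs <;> positivity) hy₀)
  refine (Finset.sum_le_sum step).trans ?_
  rw [Finset.sum_comm]
  have hper : ∀ y ∈ Bd, ∑ X ∈ (connSets d L).filter (fun X => ¬ FarFrom X Bd),
      ∑ q : Plaquette d L, (if q ∈ X ∧ maxdist y q ≤ X.card then lam ^ X.card else 0) ≤
      2 * ((2 * 3 ^ d) * lam) * (2 * Fintype.card {p : Fin d × Fin d // p.1 < p.2}) := by
    intro y _
    rw [Finset.sum_comm]
    have h1 : ∀ q : Plaquette d L, ∑ X ∈ (connSets d L).filter (fun X => ¬ FarFrom X Bd),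
        (if q ∈ X ∧ maxdist y q ≤ X.card then lam ^ X.card else 0) ≤
        ∑ X ∈ (connSets d L).filter (fun X => q ∈ X ∧ maxdist y q ≤ X.card), lam ^ X.card := by
      intro q
      rw [← Finset.sum_filter]
      refine Finset.sum_le_sum_of_subset_of_nonneg (fun X hX => ?_) fun _ _ _ => pow_nonneg hlam _
      simp only [Finset.mem_filter] at hX ⊢
      exact ⟨hX.1.1, hX.2⟩
    refine (Finset.sum_le_sum fun q _ => h1 q).trans ?_
    exact sum_near_site_le hlam hsmall y (connSets d L) fun X hX => mem_connSets.1 hX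
  calc ∑ y ∈ Bd, ∑ X ∈ (connSets d L).filter (fun X => ¬ FarFrom X Bd),
        ∑ q : Plaquette d L, (if q ∈ X ∧ maxdist y q ≤ X.card then lam ^ X.card else 0)
      ≤ ∑ _y ∈ Bd, 2 * ((2 * 3 ^ d) * lam) * (2 * Fintype.card {p : Fin d × Fin d // p.1 < p.2}) :=
        Finset.sum_le_sum hper
    _ = _ := by rw [Finset.sum_const, nsmul_eq_mul]

/-- **Total weight of the bad polymers**: big ones (`#X ≥ L/2`) are controlled by the Peierls
sum, near-boundary ones by `sum_not_far_le`, and `#X e^{-τ#X} ≤ (2e^{-τ})^{#X}`. [folklore] -/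
theorem sum_bad_le {τ : ℝ} (hsmall : ((cubeDeg d : ℝ) + 1) ^ 2 * ((2 * 3 ^ d) * (2 * Real.exp (-τ))) ≤ 1 / 2)
    (Bd : Finset (Site d L))
    [DecidablePred fun X : Finset (Plaquette d L) => 2 * X.card < L ∧ FarFrom X Bd] :
    ∑ X ∈ (connSets d L).filter (fun X => ¬ (2 * X.card < L ∧ FarFrom X Bd)),
        (X.card : ℝ) * Real.exp (-(τ * X.card)) ≤
      peierlsSum d L (2 * Real.exp (-τ)) (L / 2) +
        Bd.card * (2 * ((2 * 3 ^ d) * (2 * Real.exp (-τ))) * (2 * Fintype.card {p : Fin d × Fin d // p.1 < p.2})) := by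
  classical
  set lam : ℝ := 2 * Real.exp (-τ) with hlam
  have hlam0 : 0 ≤ lam := by positivity
  calc ∑ X ∈ (connSets d L).filter (fun X => ¬ (2 * X.card < L ∧ FarFrom X Bd)), (X.card : ℝ) * Real.exp (-(τ * X.card))
      ≤ ∑ X ∈ (connSets d L).filter (fun X => ¬ (2 * X.card < L ∧ FarFrom X Bd)), lam ^ X.card :=
        Finset.sum_le_sum fun X _ => card_mul_exp_le τ X
    _ ≤ ∑ X ∈ (connSets d L).filter (fun X => L / 2 ≤ X.card) ∪
          (connSets d L).filter (fun X => ¬ FarFrom X Bd), lam ^ X.card := by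
        refine Finset.sum_le_sum_of_subset_of_nonneg (fun X hX => ?_) fun _ _ _ => pow_nonneg hlam0 _
        rw [Finset.mem_filter] at hX
        rw [Finset.mem_union, Finset.mem_filter, Finset.mem_filter]
        by_cases hbig : L / 2 ≤ X.card
        · exact Or.inl ⟨hX.1, hbig⟩
        · refine Or.inr ⟨hX.1, fun hfar => hX.2 ⟨by omega, hfar⟩⟩
    _ ≤ ∑ X ∈ (connSets d L).filter (fun X => L / 2 ≤ X.card), lam ^ X.card +
          ∑ X ∈ (connSets d L).filter (fun X => ¬ FarFrom X Bd), lam ^ X.card := by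
        rw [← Finset.sum_union_inter]
        have : 0 ≤ ∑ X ∈ (connSets d L).filter (fun X => L / 2 ≤ X.card) ∩
            (connSets d L).filter (fun X => ¬ FarFrom X Bd), lam ^ X.card :=
          Finset.sum_nonneg fun _ _ => pow_nonneg hlam0 _
        linarith
    _ ≤ _ := add_le_add le_rfl (sum_not_far_le hlam0 hsmall Bd)

end LatticeForm

/-! ### Reality and positivity of the loop partition functions -/

namespace LatticeForm

variable {d L : ℕ} {A : Type*} [AddCommGroup A]

/-- `ext` is odd. [folklore] -/
theorem ext_neg (η : Plaquette d L → A) : ext (-η) = -ext η := by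
  funext x i j
  simp only [ext, Pi.neg_apply]
  split_ifs <;> simp

/-- `td₂` is odd. [folklore] -/
theorem td₂_neg (ω : Site d L → Fin d → Fin d → A) : td₂ (-ω) = -td₂ ω := by
  funext x i j k; simp only [td₂, Pi.neg_apply]; abel

/-- Closedness is invariant under negation. [folklore] -/
theorem isClosedPl_neg_iff (η : Plaquette d L → A) : IsClosedPl (-η) ↔ IsClosedPl η := by
  unfold IsClosedPl
  rw [ext_neg, td₂_neg]
  simp only [Pi.neg_apply, neg_eq_zero]

end LatticeForm

section Positivity

open LatticeForm

variable {d L : ℕ} [NeZero L] {G : Type*} [CommGroup G] [Fintype G] [DecidableEq G]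

omit [Fintype G] [DecidableEq G] in
/-- A unitary character satisfies `χ(g⁻¹) = conj χ(g)`. [folklore] -/
theorem chi_inv_eq_conj (χ : G →* ℂ) (hχ1 : ∀ g, ‖χ g‖ = 1) (g : G) : χ g⁻¹ = starRingEnd ℂ (χ g) := by
  have hinv : χ g⁻¹ = (χ g)⁻¹ := eq_inv_of_mul_eq_one_right (by rw [← map_mul, mul_inv_cancel, map_one])
  rw [hinv, Complex.inv_def, Complex.normSq_eq_norm_sq, hχ1]
  simp

omit [NeZero L] [Fintype G] [DecidableEq G] in
/-- Complex conjugation of the loop observable is the loop observable of the negated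
configuration. [folklore] -/
theorem conj_loopObs (χ : G →* ℂ) (hχ1 : ∀ g, ‖χ g‖ = 1) (s : ℝ) {i j : Fin d} (hij : i < j) (R T : ℕ)
    (η : Plaquette d L → Additive G) :
    starRingEnd ℂ (loopObs χ s hij R T η) = loopObs χ s hij R T (-η) := by
  unfold loopObs
  rw [map_prod]
  refine Finset.prod_congr rfl fun b _ => ?_
  rw [map_prod]
  refine Finset.prod_congr rfl fun a _ => ?_
  rw [map_add, map_mul, Complex.conj_ofReal, map_sub, map_one, Complex.conj_ofReal, Pi.neg_apply, toMul_neg,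
    chi_inv_eq_conj χ hχ1]

omit [Fintype G] [DecidableEq G] in
/-- An even weight gives an even Gibbs factor. [folklore] -/
theorem Wt_neg {φ : Additive G → ℝ} (hφ : ∀ a, φ (-a) = φ a) (η : Plaquette d L → Additive G) :
    Wt φ (-η) = Wt φ η := by
  unfold Wt; exact Finset.prod_congr rfl fun p _ => hφ _

/-- **The loop partition functions are real** (symmetry `η ↦ -η` of the closed ensemble).
[folklore] -/
theorem conj_Zobs_loopObs {φ : Additive G → ℝ} (hφ : ∀ a, φ (-a) = φ a) (χ : G →* ℂ)
    (hχ1 : ∀ g, ‖χ g‖ = 1) (s : ℝ) {i j : Fin d} (hij : i < j) (R T : ℕ) :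
    starRingEnd ℂ (Zobs (L := L) φ (loopObs χ s hij R T)) = Zobs (L := L) φ (loopObs χ s hij R T) := by
  unfold Zobs
  rw [map_sum]
  simp only [map_mul, Complex.conj_ofReal, conj_loopObs χ hχ1]
  refine Finset.sum_equiv (Equiv.neg _) (fun η => ?_) (fun η _ => ?_)
  · simp only [mem_Closed, Equiv.neg_apply, isClosedPl_neg_iff]
  · simp only [Equiv.neg_apply, Wt_neg hφ]

/-- The loop partition function is continuous in the interpolation parameter. [folklore] -/
theorem continuous_Zobs_loopObs (φ : Additive G → ℝ) (χ : G →* ℂ) {i j : Fin d} (hij : i < j) (R T : ℕ) :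
    Continuous fun s : ℝ => Zobs (L := L) φ (loopObs χ s hij R T) := by
  unfold Zobs loopObs
  refine continuous_finsetSum _ fun η _ => continuous_const.mul ?_
  refine continuous_finsetProd _ fun b _ => continuous_finsetProd _ fun a _ => ?_
  exact (Complex.continuous_ofReal.mul continuous_const).add (continuous_const.sub Complex.continuous_ofReal)

/-- **Positivity of the loop partition function**: in the KP regime with an even weight and a
unitary character, `Z(ψ₁)` is real and positive — it is real for every interpolation parameter,
non-zero on `[0,1]` (the cluster expansion converges for `|ψ_s| ≤ 1`), continuous, and equal to
`Z(1) > 0` at `s = 0`. [folklore] -/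
theorem Zobs_loopObs_pos {φ : Additive G → ℝ} {ε τ : ℝ} (h : KPRegime d (Additive G) φ ε τ)
    (hφ : ∀ a, φ (-a) = φ a) (χ : G →* ℂ) (hχ1 : ∀ g, ‖χ g‖ = 1) {i j : Fin d} (hij : i < j) (R T : ℕ) :
    0 < (Zobs (L := L) φ (loopObs χ 1 hij R T)).re ∧ (Zobs (L := L) φ (loopObs χ 1 hij R T)).im = 0 := by
  set f : ℝ → ℝ := fun s => (Zobs (L := L) φ (loopObs χ s hij R T)).re with hf
  have him : ∀ s : ℝ, (Zobs (L := L) φ (loopObs χ s hij R T)).im = 0 := fun s =>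
    Complex.conj_eq_iff_im.1 (conj_Zobs_loopObs hφ χ hχ1 s hij R T)
  have hcont : Continuous f := Complex.continuous_re.comp (continuous_Zobs_loopObs φ χ hij R T)
  have hne : ∀ s ∈ Set.Icc (0 : ℝ) 1, Zobs (L := L) φ (loopObs χ s hij R T) ≠ 0 := by
    intro s hs
    rw [h.Z_eq_exp_sum_truncatedWeight (isMultObs_loopObs χ s hij R T) (norm_loopObs_le χ hχ1 hs.1 hs.2 hij R T)]
    exact Complex.exp_ne_zero _
  have h0 : 0 < f 0 := by
    have hobs : loopObs (L := L) χ 0 hij R T = fun _ => 1 := by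
      funext η; unfold loopObs; simp
    have hWt0 : ∀ η : Plaquette d L → Additive G, 0 ≤ Wt φ η := fun η => Wt_nonneg h.nonneg η
    have hZ : Zobs (L := L) φ (fun _ : Plaquette d L → Additive G => (1 : ℂ)) =
        ((∑ η ∈ Closed d L (Additive G), Wt φ η : ℝ) : ℂ) := by
      unfold Zobs; push_cast; exact Finset.sum_congr rfl fun η _ => mul_one _
    have hpos : 0 < ∑ η ∈ Closed d L (Additive G), Wt φ η := by
      have hmem : (0 : Plaquette d L → Additive G) ∈ Closed d L (Additive G) := mem_Closed.2 isClosedPl_zero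
      have hW0 : Wt φ (0 : Plaquette d L → Additive G) = 1 := by simp [Wt, h.zero]
      calc (0 : ℝ) < 1 := one_pos
        _ = Wt φ (0 : Plaquette d L → Additive G) := hW0.symm
        _ ≤ _ := Finset.single_le_sum (fun η _ => hWt0 η) hmem
    rw [hf]; dsimp only
    rw [hobs, hZ, Complex.ofReal_re]
    exact hpos
  refine ⟨?_, him 1⟩
  by_contra hle
  push Not at hle
  have hmem : (0 : ℝ) ∈ Set.Icc (f 1) (f 0) := ⟨hle, h0.le⟩
  obtain ⟨s, hs, hfs⟩ := intermediate_value_Icc' (zero_le_one (α := ℝ)) hcont.continuousOn hmem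
  apply hne s hs
  apply Complex.ext
  · simpa [hf] using hfs
  · simpa using him s

/-- **The loop expectation in the closed ensemble is at least `e^{-‖∑_C dPhi‖}`.** [folklore] -/
theorem exp_neg_norm_le_closedAvg_re {φ : Additive G → ℝ} {ε τ : ℝ} (h : KPRegime d (Additive G) φ ε τ)
    (hφ : ∀ a, φ (-a) = φ a) (χ : G →* ℂ) (hχ1 : ∀ g, ‖χ g‖ = 1) {i j : Fin d} (hij : i < j) (R T : ℕ) :
    Real.exp (-‖∑ C ∈ (connSets d L).powerset, dPhi φ (loopObs χ 1 hij R T) C‖) ≤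
      (closedAvg (L := L) φ (loopObs χ 1 hij R T)).re := by
  set ψ := loopObs (L := L) χ 1 hij R T with hψ
  have hone : ∀ η : Plaquette d L → Additive G, ‖(fun _ : Plaquette d L → Additive G => (1 : ℂ)) η‖ ≤ 1 :=
    fun _ => by simp
  have hb : ∀ η, ‖ψ η‖ ≤ 1 := norm_loopObs_le χ hχ1 zero_le_one le_rfl hij R T
  -- the ratio as an exponential
  have hZψ := h.Z_eq_exp_sum_truncatedWeight (isMultObs_loopObs χ 1 hij R T) hb
  have hZ1 := h.Z_eq_exp_sum_truncatedWeight (L := L) isMultObs_one hone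
  have hratio : closedAvg φ ψ = Complex.exp (∑ C ∈ (connSets d L).powerset, dPhi φ ψ C) := by
    rw [closedAvg, hZψ, hZ1, ← Complex.exp_sub, ← Finset.sum_sub_distrib]; rfl
  -- the ratio is real and positive
  obtain ⟨hre, him⟩ := Zobs_loopObs_pos (L := L) h hφ χ hχ1 hij R T
  have hZ1real : Zobs (L := L) φ (fun _ : Plaquette d L → Additive G => (1 : ℂ)) =
      ((∑ η ∈ Closed d L (Additive G), Wt φ η : ℝ) : ℂ) := by
    unfold Zobs; push_cast; exact Finset.sum_congr rfl fun η _ => mul_one _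
  have hZ1pos : 0 < ∑ η ∈ Closed d L (Additive G), Wt φ η := by
    have hWt0 : ∀ η : Plaquette d L → Additive G, 0 ≤ Wt φ η := fun η => Wt_nonneg h.nonneg η
    have hmem : (0 : Plaquette d L → Additive G) ∈ Closed d L (Additive G) := mem_Closed.2 isClosedPl_zero
    have hW0 : Wt φ (0 : Plaquette d L → Additive G) = 1 := by simp [Wt, h.zero]
    calc (0 : ℝ) < 1 := one_pos
      _ = Wt φ (0 : Plaquette d L → Additive G) := hW0.symm
      _ ≤ _ := Finset.single_le_sum (fun η _ => hWt0 η) hmem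
  have hψreal : Zobs φ ψ = (((Zobs φ ψ).re : ℝ) : ℂ) := by
    apply Complex.ext
    · simp
    · rw [Complex.ofReal_im]; exact him
  have havg_real : closedAvg φ ψ = (((Zobs φ ψ).re / ∑ η ∈ Closed d L (Additive G), Wt φ η : ℝ) : ℂ) := by
    rw [closedAvg, hZ1real]
    conv_lhs => rw [hψreal]
    push_cast; rfl
  have havg_pos : 0 < (Zobs φ ψ).re / ∑ η ∈ Closed d L (Additive G), Wt φ η := div_pos hre hZ1pos
  -- conclude
  set S := ∑ C ∈ (connSets d L).powerset, dPhi φ ψ C with hS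
  have hnorm : ‖closedAvg φ ψ‖ = Real.exp S.re := by rw [hratio, Complex.norm_exp]
  have hre_eq : (closedAvg φ ψ).re = ‖closedAvg φ ψ‖ := by
    rw [havg_real, Complex.ofReal_re, Complex.norm_real, Real.norm_eq_abs, abs_of_pos havg_pos]
  rw [hre_eq, hnorm]
  refine Real.exp_le_exp.2 ?_
  have h1 := Complex.abs_re_le_norm S
  have h2 := neg_abs_le S.re
  linarith

end Positivity

/-! ### The perimeter law -/

section PerimeterLaw

open LatticeForm

variable {d L N : ℕ} [NeZero L] {G : Type*} [CommGroup G] [Fintype G] [DecidableEq G]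

omit [NeZero L] [DecidableEq G] in
/-- The KP regime with a general decay parameter `τ ≥ 0`. [folklore] -/
theorem kpRegime_wilsonPhi_tau (ρ : G →* Matrix (Fin N) (Fin N) ℂ) {β δ τ : ℝ} (hβ : 0 ≤ β) (hτ : 0 ≤ τ)
    (hgap : ∀ g : G, g ≠ 1 → δ ≤ (N : ℝ) - (ρ g).trace.re)
    (hsmall : ((cubeDeg d : ℝ) + 1) ^ 2 *
      ((Fintype.card (Additive G) : ℝ) * Real.exp (-(β * δ)) * Real.exp (1 + τ)) ≤ 1 / 2) :
    KPRegime d (Additive G) (wilsonPhi ρ β) (Real.exp (-(β * δ))) τ where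
  zero := wilsonPhi_zero ρ β
  nonneg := wilsonPhi_nonneg ρ β
  eps_nonneg := (Real.exp_pos _).le
  le_eps := wilsonPhi_le_of_gap ρ hβ hgap
  tau_nonneg := hτ
  small := hsmall

omit [NeZero L] [Fintype G] [DecidableEq G] in
/-- For `δ > 0` the `τ`-smallness condition holds for all large `β`. [folklore] -/
theorem eventually_kp_small_tau (d : ℕ) (M τ : ℝ) {δ : ℝ} (hδ : 0 < δ) :
    ∃ β₀ : ℝ, 0 ≤ β₀ ∧ ∀ β : ℝ, β₀ ≤ β →
      ((cubeDeg d : ℝ) + 1) ^ 2 * (M * Real.exp (-(β * δ)) * Real.exp (1 + τ)) ≤ 1 / 2 := by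
  have ht : Tendsto (fun β : ℝ => ((cubeDeg d : ℝ) + 1) ^ 2 * (M * Real.exp (-(β * δ)) * Real.exp (1 + τ)))
      atTop (𝓝 0) := by
    have h1 : Tendsto (fun β : ℝ => β * δ) atTop atTop := tendsto_id.atTop_mul_const hδ
    have h2 : Tendsto (fun β : ℝ => Real.exp (-(β * δ))) atTop (𝓝 0) :=
      Real.tendsto_exp_neg_atTop_nhds_zero.comp h1
    have h3 := (tendsto_const_nhds (x := ((cubeDeg d : ℝ) + 1) ^ 2)).mul
      (((tendsto_const_nhds (x := M)).mul h2).mul (tendsto_const_nhds (x := Real.exp (1 + τ))))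
    simpa using h3
  have hev := (ht.eventually (gt_mem_nhds (by norm_num : (0 : ℝ) < 1 / 2)))
  obtain ⟨β₁, hβ₁⟩ := Filter.eventually_atTop.1 hev
  exact ⟨max β₁ 0, le_max_right _ _, fun β hβ => (hβ₁ β ((le_max_left _ _).trans hβ)).le⟩

omit [NeZero L] [Fintype G] [DecidableEq G] in
/-- A symmetric Wilson energy gives an even plaquette weight. [folklore] -/
theorem wilsonPhi_neg (ρ : G →* Matrix (Fin N) (Fin N) ℂ) (hsymm : ∀ g : G, (ρ g⁻¹).trace.re = (ρ g).trace.re)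
    (β : ℝ) (a : Additive G) : wilsonPhi ρ β (-a) = wilsonPhi ρ β a := by
  unfold wilsonPhi; rw [toMul_neg, hsymm]

omit [NeZero L] [Fintype G] [DecidableEq G] in
/-- **Stokes for the loop variable**: the rectangle holonomy is the exponential of the total flux of
the plaquette field. [folklore] -/
theorem toMul_rectFlux_plaqField (U : GaugeConfig d L G) {i j : Fin d} (hij : i < j) (R T : ℕ) :
    Additive.toMul (rectFlux hij R T (plaqField U)) = rectangleHolonomy U 0 i j R T := by
  apply Additive.ofMul.injective
  rw [ofMul_toMul, ofMul_rectangleHolonomy]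
  unfold rectFlux
  refine Finset.sum_congr rfl fun b _ => Finset.sum_congr rfl fun a _ => ?_
  rw [plaqField_apply, zero_add]
  rfl

/-- The real part of a complex exact-ensemble expectation is the expectation of the real part.
[folklore] -/
theorem exactAvg_re (φ : Additive G → ℝ) (f : (Plaquette d L → Additive G) → ℂ) :
    (exactAvg φ f).re = exactAvgR φ (fun η => (f η).re) := by
  rw [exactAvg, exactAvgR]
  have hden : ∑ η ∈ Img d L G, (Wt φ η : ℂ) = ((∑ η ∈ Img d L G, Wt φ η : ℝ) : ℂ) := by push_cast; rfl
  rw [hden, Complex.div_ofReal_re, Complex.re_sum]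
  congr 1
  exact Finset.sum_congr rfl fun η _ => Complex.re_ofReal_mul _ _

/-- **The torus Wilson loop expectation as an exact-ensemble expectation of the loop observable.**
[folklore] -/
theorem wilsonExpectation_loop_eq [TopologicalSpace G] [DiscreteTopology G] [IsTopologicalGroup G]
    [MeasurableSpace G] [BorelSpace G] (ρ : G →* Matrix (Fin N) (Fin N) ℂ) (hρ : Continuous ρ) (β : ℝ)
    (χ : G →* ℂ) {i j : Fin d} (hij : i < j) (R T : ℕ) :
    wilsonExpectation ρ β (fun U : GaugeConfig d L G => (χ (rectangleHolonomy U 0 i j R T)).re) =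
      (exactAvg (wilsonPhi ρ β) (loopObs (L := L) χ 1 hij R T)).re := by
  rw [wilsonExpectation_eq_gibbsAverage ρ hρ β, exactAvg_re]
  have hnum : ∑ U : GaugeConfig d L G, (χ (rectangleHolonomy U 0 i j R T)).re * Real.exp (-β * wilsonAction ρ U) =
      ∑ U : GaugeConfig d L G, (loopObs χ 1 hij R T (plaqField U)).re * Wt (wilsonPhi ρ β) (plaqField U) :=
    Finset.sum_congr rfl fun U _ => by
      rw [loopObs_one, toMul_rectFlux_plaqField, exp_neg_mul_wilsonAction]
  have hden : ∑ U : GaugeConfig d L G, Real.exp (-β * wilsonAction ρ U) =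
      ∑ U : GaugeConfig d L G, Wt (wilsonPhi ρ β) (plaqField U) :=
    Finset.sum_congr rfl fun U _ => exp_neg_mul_wilsonAction ρ β U
  rw [hnum, hden]
  exact gibbsAverage_eq_exactAvgR (wilsonPhi ρ β) (fun _ => rfl) (fun η => (loopObs χ 1 hij R T η).re)

/-- **The perimeter law in the Higgs phase of finite abelian lattice gauge theories (torus states,
uniformly in the volume).** Let `G` be a finite abelian group, `ρ` a continuous matrix
representation with an action gap `δ > 0` and a symmetric Wilson energy, `χ` a unitary character,
`d ≥ 3`, `i < j`. There is `β_f` such that for every `β > β_f` there is `c` with: for all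
`R, T ≥ 1` and all sufficiently large torus sizes `L + 1`,
`e^{-c · 2(R+T)} ≤ ⟨Re χ(hol_{R×T})⟩_{Λ_{L+1}, β}` ("Peierls argument for the Wilson loop").
[cite: MontvayMunster1994, §3.7.1 item 3 (PDF p. 164)] [cite: ForsstromLenellsViklund2022, Thm. 1.1] -/
theorem abelianHiggs_torus_perimeterLaw {d N : ℕ} (hd : 3 ≤ d) {G : Type*} [CommGroup G] [Fintype G]
    [DecidableEq G] [TopologicalSpace G] [DiscreteTopology G] [IsTopologicalGroup G] [MeasurableSpace G]
    [BorelSpace G] (ρ : G →* Matrix (Fin N) (Fin N) ℂ) (hρ : Continuous ρ) {δ : ℝ} (hδ : 0 < δ)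
    (hgap : ∀ g : G, g ≠ 1 → δ ≤ (N : ℝ) - (ρ g).trace.re)
    (hsymm : ∀ g : G, (ρ g⁻¹).trace.re = (ρ g).trace.re) (χ : G →* ℂ) (hχ1 : ∀ g, ‖χ g‖ = 1)
    {i j : Fin d} (hij : i < j) :
    ∃ β_f : ℝ, ∀ β : ℝ, β_f < β → ∃ c : ℝ, ∀ R T : ℕ, 1 ≤ R → 1 ≤ T → ∀ᶠ L : ℕ in atTop,
      Real.exp (-c * (2 * (R + T))) ≤
        wilsonExpectation (L := L + 1) ρ β (fun U => (χ (rectangleHolonomy U 0 i j R T)).re) := by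
  classical
  -- the decay parameter
  set τ : ℝ := Real.log (8 * 3 ^ d * ((cubeDeg d : ℝ) + 1) ^ 2) with hτ
  have harg : (1 : ℝ) ≤ 8 * 3 ^ d * ((cubeDeg d : ℝ) + 1) ^ 2 := by
    have h1 : (1 : ℝ) ≤ 3 ^ d := one_le_pow₀ (by norm_num)
    have h2 : (1 : ℝ) ≤ ((cubeDeg d : ℝ) + 1) ^ 2 := one_le_pow₀ (by
      have : (0 : ℝ) ≤ cubeDeg d := Nat.cast_nonneg _; linarith)
    nlinarith
  have hτ0 : 0 ≤ τ := Real.log_nonneg harg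
  have hexpτ : Real.exp (-τ) = (8 * 3 ^ d * ((cubeDeg d : ℝ) + 1) ^ 2)⁻¹ := by
    rw [Real.exp_neg, hτ, Real.exp_log (by linarith)]
  have hsmallτ : ((cubeDeg d : ℝ) + 1) ^ 2 * ((2 * 3 ^ d) * (2 * Real.exp (-τ))) ≤ 1 / 2 := by
    rw [hexpτ]
    have hpos : (0 : ℝ) < 8 * 3 ^ d * ((cubeDeg d : ℝ) + 1) ^ 2 := by linarith
    rw [show ((cubeDeg d : ℝ) + 1) ^ 2 * ((2 * 3 ^ d) * (2 * (8 * 3 ^ d * ((cubeDeg d : ℝ) + 1) ^ 2)⁻¹)) =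
      (4 * 3 ^ d * ((cubeDeg d : ℝ) + 1) ^ 2) / (8 * 3 ^ d * ((cubeDeg d : ℝ) + 1) ^ 2) by ring]
    rw [div_le_iff₀ hpos]
    linarith
  have hsmallτ' : ((cubeDeg d : ℝ) + 1) ^ 2 * (2 * (2 * Real.exp (-τ))) ≤ 1 / 2 := by
    refine le_trans ?_ hsmallτ
    refine mul_le_mul_of_nonneg_left (mul_le_mul_of_nonneg_right ?_ (by positivity)) (by positivity)
    have : (1 : ℝ) ≤ 3 ^ d := one_le_pow₀ (by norm_num)
    linarith
  -- the regime
  set Mc : ℝ := (Fintype.card (Additive G) : ℝ) with hMc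
  obtain ⟨β₀, hβ₀0, hβ₀⟩ := eventually_kp_small_tau d Mc τ hδ
  refine ⟨β₀, fun β hβ => ?_⟩
  have hβ0 : 0 ≤ β := hβ₀0.trans hβ.le
  set ε : ℝ := Real.exp (-(β * δ)) with hε
  set φ : Additive G → ℝ := wilsonPhi ρ β with hφ
  have hKP : KPRegime d (Additive G) φ ε τ := kpRegime_wilsonPhi_tau ρ hβ0 hτ0 hgap (hβ₀ β hβ.le)
  have hφsymm : ∀ a, φ (-a) = φ a := wilsonPhi_neg ρ hsymm β
  have hMc1 : 1 ≤ Mc := by rw [hMc]; exact_mod_cast Fintype.card_pos (α := Additive G)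
  have hε0 : 0 ≤ ε := (Real.exp_pos _).le
  have hlam0 : 0 ≤ Mc * ε := mul_nonneg (by linarith) hε0
  have hsmall2 : ((cubeDeg d : ℝ) + 1) ^ 2 * (2 * (Mc * ε)) ≤ 1 / 2 := by
    have he2 : (2 : ℝ) ≤ Real.exp (1 + τ) := by
      have := Real.add_one_le_exp (1 + τ); linarith
    have h1 : 2 * (Mc * ε) ≤ Mc * ε * Real.exp (1 + τ) := by nlinarith
    exact le_trans (mul_le_mul_of_nonneg_left h1 (by positivity)) (hβ₀ β hβ.le)
  -- the constants
  set Pl : ℝ := (Fintype.card {p : Fin d × Fin d // p.1 < p.2} : ℝ) with hPl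
  set Kb : ℝ := 2 * ((2 * 3 ^ d) * (2 * Real.exp (-τ))) * (2 * Pl) with hKb
  have hKb0 : 0 ≤ Kb := by rw [hKb]; positivity
  set c : ℝ := 2 * Kb + 1 with hc
  refine ⟨c, fun R T hR hT => ?_⟩
  -- eventual smallness of the two Peierls sums
  have hev : ∀ᶠ L : ℕ in atTop,
      peierlsSum d (L + 1) (2 * Real.exp (-τ)) ((L + 1) / 2) < 1 / 2 ∧
      peierlsSum d (L + 1) (Mc * ε) ((L + 1) / 2) <
        min (1 / 2) (Real.exp (-1) * Real.exp (-(2 * Kb) * (2 * (R + T))) / 8) := by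
    refine Filter.Eventually.and ?_ ?_
    · have ht := tendsto_peierlsSum d (by positivity : (0 : ℝ) ≤ 2 * Real.exp (-τ)) hsmallτ'
      exact (tendsto_order.1 ht).2 _ (by norm_num)
    · have ht := tendsto_peierlsSum d hlam0 hsmall2
      exact (tendsto_order.1 ht).2 _ (lt_min (by norm_num) (by positivity))
  refine hev.mono fun L hL => ?_
  obtain ⟨hpS, hδL⟩ := hL
  -- the identity and the comparison with the closed ensemble
  set ψ := loopObs (L := L + 1) χ 1 hij R T with hψ
  have hb : ∀ η, ‖ψ η‖ ≤ 1 := norm_loopObs_le χ hχ1 zero_le_one le_rfl hij R T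
  have hδhalf : peierlsSum d (L + 1) ((Fintype.card (Additive G) : ℝ) * ε) ((L + 1) / 2) ≤ 1 / 2 :=
    (hδL.trans_le (min_le_left _ _)).le
  have hcomp := norm_exactAvg_sub_closedAvg_le (d := d) (L := L + 1) hd hKP.zero hKP.nonneg hε0 hKP.le_eps ψ hb hδhalf
  have hclosed := exp_neg_norm_le_closedAvg_re (L := L + 1) hKP hφsymm χ hχ1 hij R T
  -- the cluster sum is of perimeter size
  set Bd := rectBoundary (L := L + 1) i j R T with hBd
  have hgood : ∀ X ∈ connSets d (L + 1), (2 * X.card < L + 1 ∧ FarFrom X Bd) →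
      act φ ψ X = act φ (fun _ : Plaquette d (L + 1) → Additive G => (1 : ℂ)) X :=
    fun X hX hg => act_loopObs_eq_of_far hd φ χ hij R T (mem_connSets.1 hX) hg.1 hg.2
  have hS := hKP.norm_sum_dPhi_le_of_good hb (fun X => 2 * X.card < L + 1 ∧ FarFrom X Bd) hgood
  have hbad := sum_bad_le (L := L + 1) (τ := τ) hsmallτ Bd
  have hBdcard : (Bd.card : ℝ) ≤ 2 * (R + T) := by
    rw [hBd]; exact_mod_cast card_rectBoundary_le (L := L + 1) i j R T
  have hnormS : ‖∑ C ∈ (connSets d (L + 1)).powerset, dPhi φ ψ C‖ ≤ 1 + (2 * Kb) * (2 * (R + T)) := by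
    refine hS.trans ?_
    have h1 : (Bd.card : ℝ) * Kb ≤ 2 * (R + T) * Kb := mul_le_mul_of_nonneg_right hBdcard hKb0
    have h2 := hbad
    rw [← hKb] at h2
    nlinarith [hpS.le, h1, h2]
  -- assemble
  rw [wilsonExpectation_loop_eq ρ hρ β χ hij R T]
  have hre : (closedAvg φ ψ).re - 4 * peierlsSum d (L + 1) ((Fintype.card (Additive G) : ℝ) * ε) ((L + 1) / 2) ≤
      (exactAvg φ ψ).re := by
    have := Complex.abs_re_le_norm (exactAvg φ ψ - closedAvg φ ψ)
    rw [Complex.sub_re] at this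
    have := abs_le.1 (this.trans hcomp)
    linarith [this.1]
  refine le_trans ?_ hre
  have hδb : 4 * peierlsSum d (L + 1) ((Fintype.card (Additive G) : ℝ) * ε) ((L + 1) / 2) ≤
      Real.exp (-1) * Real.exp (-(2 * Kb) * (2 * (R + T))) / 2 := by
    have := (hδL.trans_le (min_le_right _ _)).le
    rw [← hMc]; linarith
  have hmain : Real.exp (-1) * Real.exp (-(2 * Kb) * (2 * (R + T))) ≤ (closedAvg φ ψ).re := by
    refine le_trans ?_ hclosed
    rw [← Real.exp_add]
    exact Real.exp_le_exp.2 (by linarith)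
  have hRT : (4 : ℝ) ≤ 2 * (R + T) := by
    have : (1 : ℝ) ≤ R := by exact_mod_cast hR
    have : (1 : ℝ) ≤ T := by exact_mod_cast hT
    linarith
  -- `e^{-c·2(R+T)} ≤ (1/2) e^{-1} e^{-2Kb·2(R+T)}`
  have hhalf : Real.exp (-c * (2 * (R + T))) ≤ Real.exp (-1) * Real.exp (-(2 * Kb) * (2 * (R + T))) / 2 := by
    have he3 : Real.exp (-(2 * ((R : ℝ) + T))) ≤ Real.exp (-1) / 2 := by
      have h4 : Real.exp (-(2 * ((R : ℝ) + T))) ≤ Real.exp (-4) := Real.exp_le_exp.2 (by linarith)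
      have h5 : Real.exp (-4 : ℝ) * 2 ≤ Real.exp (-1) := by
        have h6 : (2 : ℝ) ≤ Real.exp 3 := by have := Real.add_one_le_exp (3 : ℝ); linarith
        calc Real.exp (-4 : ℝ) * 2 ≤ Real.exp (-4) * Real.exp 3 :=
              mul_le_mul_of_nonneg_left h6 (Real.exp_nonneg _)
          _ = Real.exp (-1) := by rw [← Real.exp_add]; norm_num
      linarith
    calc Real.exp (-c * (2 * (R + T))) = Real.exp (-(2 * Kb) * (2 * (R + T))) * Real.exp (-(2 * ((R : ℝ) + T))) := by
          rw [← Real.exp_add, hc]; ring_nf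
      _ ≤ Real.exp (-(2 * Kb) * (2 * (R + T))) * (Real.exp (-1) / 2) :=
          mul_le_mul_of_nonneg_left he3 (Real.exp_nonneg _)
      _ = Real.exp (-1) * Real.exp (-(2 * Kb) * (2 * (R + T))) / 2 := by ring
  linarith

end PerimeterLaw

end Literature.MathematicalPhysics.QuantumFieldTheory

end
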